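import Summits.Ventures.GridStability.Bench.WSCC9KBox
import Summits.Ventures.GridStability.Models.WSCC9FaultOnTubeLegs36
import HarnessLib

/-!
# WSCC9FaultTube36KBoxGlue — the «K ⊂ S» RECEPTACLE for the 36-leg kernel tube: a `KBox` that COVERS a slice box contains the clearing state

Venture GRIDFUSION (LADDER-GRIDFUSION G1-cct, «#61⁗»-successor input, #92-cand «G1cct-WSCC9-FAULT-TUBE36»; seat gridfusion-model-1 g6).
The next-wave clearing-time riders past `23/200 s` consume model-1's 36-leg tube (`Models/WSCC9FaultOnTubeLegs36`, `FaultOnLeg.legs36`,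
`faultBus7_clearingState36`) through sos-3's `KBox` machinery (`Bench/WSCC9KBox`, v-frame speeds `v = ω − ω∞′`).  This file is the
one-lemma bridge: `KBox.coversSlice B S` (Bool; twelve rational comparisons: `B`'s corners dominate the slice box `S` with the speeds shifted
by `−ω∞′`) and `KBox.clearingState36_mem` — for a clearing time `T` with `T − k/200 ∈ [sa, sb]` (admissible slice, `sliceOK` by `decide`),
every fault-on solution `Y` of `WSCC9.faultBus7Printed` from the printed pre-fault point at synchronous speed, and every post-fault curve `c`
started at the cleared state `c 0 = (δ(T), ω(T) − ω∞′)`: `B.coversSlice S ⇒ c 0 ∈ B.toSet`.  A closing file then needs, per slice, ONE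
`coversSlice` decide and ONE ROA certificate on `B`.  THREE COLUMNS: CERTIFIED = containment lemma (pure inequalities) for MODEL M′ (classical
WSCC9, bus-7 fault of record, MV-2 + MV-P + MV-SPD + MV-ω + MV-h12); nothing VALIDATED; no stability sentence here.
[cite: Moore1979, §8.1 eq. (8.10); AndersonFouad1977, Example 2.6 / §2.10]
-/

noncomputable section

open Real Set
open Summit.Ventures.GridStability.Models

namespace Summit.Ventures.GridStability.Bench.WSCC9

namespace KBox

/-- `B` COVERS the slice box `S` (printed speeds shifted to the v-frame by `−ω∞′`): twelve rational comparisons. [folklore] -/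
def coversSlice (B : KBox) (S : Models.WSCC9.FaultOnLeg.SliceBox) : Bool :=
  decide (B.a2lo ≤ S.a2lo) && decide (S.a2hi ≤ B.a2hi) && decide (B.a3lo ≤ S.a3lo) && decide (S.a3hi ≤ B.a3hi) &&
  decide (∀ j : Fin 3, B.vlo j ≤ S.wlo j - Models.WSCC9.omegaInf ∧ S.whi j - Models.WSCC9.omegaInf ≤ B.vhi j)

/-- `B.coversSlice S` and `x ∈ S` (printed frame) ⇒ the v-frame state `(x.δ, x.ω − ω∞′)` lies in `B`. [folklore] -/
theorem mem_of_coversSlice {B : KBox} {S : Models.WSCC9.FaultOnLeg.SliceBox} (h : B.coversSlice S = true)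
    {x : ClassicalSwing.State 3} (hx : x ∈ S.toSet) :
    ((x.1, fun j => x.2 j - (Models.WSCC9.omegaInf : ℝ)) : ClassicalSwing.State 3) ∈ B.toSet := by
  simp only [coversSlice, Bool.and_eq_true, decide_eq_true_eq] at h
  obtain ⟨⟨⟨⟨h1, h2⟩, h3⟩, h4⟩, h5⟩ := h
  rw [Models.WSCC9.FaultOnLeg.SliceBox.mem_toSet] at hx
  obtain ⟨x1, x2, x3, x4, x5⟩ := hx
  have c1 := (Rat.cast_le (K := ℝ)).2 h1
  have c2 := (Rat.cast_le (K := ℝ)).2 h2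
  have c3 := (Rat.cast_le (K := ℝ)).2 h3
  have c4 := (Rat.cast_le (K := ℝ)).2 h4
  rw [mem_toSet_iff]
  refine ⟨⟨by linarith, by linarith⟩, ⟨by linarith, by linarith⟩, fun j => ?_⟩
  obtain ⟨l, u⟩ := h5 j
  have cl := (Rat.cast_le (K := ℝ)).2 l
  have cu := (Rat.cast_le (K := ℝ)).2 u
  push_cast at cl cu
  obtain ⟨y1, y2⟩ := x5 j
  exact ⟨by linarith, by linarith⟩

/-- **THE RECEPTACLE.**  `k < 36`, an admissible slice `(sa, sb)` of leg `k` of model-1's 36-leg tube, a `KBox` `B` covering its slice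
box, a clearing time `T ∈ [k/200 + sa, k/200 + sb]`, a fault-on solution `Y` of `WSCC9.faultBus7Printed` on `[0, T]` from the printed
pre-fault point at synchronous speed, and a post-fault curve `c` with `c 0 = (δ(T), ω(T) − ω∞′)` ⇒ `c 0 ∈ B.toSet`.  MODELLED: classical
WSCC9 M′, bus-7 fault of record. [folklore] -/
theorem clearingState36_mem {k : ℕ} (hk : k < 36) {sa sb : ℚ}
    (hs : (Models.WSCC9.FaultOnLeg.legAt Models.WSCC9.FaultOnLeg.legs36 k).sliceOK
      (Models.WSCC9.FaultOnLeg.kboxAt Models.WSCC9.FaultOnLeg.K0 Models.WSCC9.FaultOnLeg.legs36 k) sa sb = true)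
    {B : KBox} (hB : B.coversSlice ((Models.WSCC9.FaultOnLeg.legAt Models.WSCC9.FaultOnLeg.legs36 k).sliceBox
      (Models.WSCC9.FaultOnLeg.kboxAt Models.WSCC9.FaultOnLeg.K0 Models.WSCC9.FaultOnLeg.legs36 k) sa sb) = true)
    {T : ℝ} (hT1 : (k : ℝ) / 200 + (sa : ℝ) ≤ T) (hT2 : T ≤ (k : ℝ) / 200 + (sb : ℝ))
    {Y : ℝ → ClassicalSwing.State 3} (hY : Models.WSCC9.faultBus7Printed.IsSolutionOn Y (Icc 0 T)) (hω0 : (Y 0).2 = 0)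
    (ha2 : (Y 0).1 1 - (Y 0).1 0 ∈ Models.WSCC9.a2Window) (ha3 : (Y 0).1 2 - (Y 0).1 0 ∈ Models.WSCC9.a3Window)
    {c : ℝ → ClassicalSwing.State 3} (hc0 : c 0 = ((Y T).1, fun j => (Y T).2 j - (Models.WSCC9.omegaInf : ℝ))) :
    c 0 ∈ B.toSet := by
  rw [hc0]
  exact mem_of_coversSlice hB (Models.WSCC9.FaultOnLeg.faultBus7_clearingState36 hk hs hT1 hT2 hY hω0 ha2 ha3)

end KBox

end Summit.Ventures.GridStability.Bench.WSCC9

end
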